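import Summits.BirchSwinnertonDyer.BirchSwinnertonDyer.Theorems.AlignedTransportAtTwoMainConjectureOfRankZeroBSDAtTwoCubicDepthDoorGenusCert
import Summits.BirchSwinnertonDyer.BirchSwinnertonDyer.Theorems.AlignedTransportAtTwoMainConjectureOfRankZeroBSDAtTwoCubicDoorsDeadSubcellClassNumberI
import Literature.NumberTheory.IwasawaTheory.CyclotomicTwoLayerTwoNormForm
import Literature.NumberTheory.NumberFields.CubicFieldIntegers
import Literature.NumberTheory.NumberFields.CubicFieldResiduePrimes
import HarnessLib

/-!
# Route `AlignedTransportAtTwo`, crux C2 `MainConjectureOfRankZeroBSDAtTwo` (stmt-BirchSwinnertonDyer-22298):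
# THE DEPTH DOOR'S FIRST CUSTOMER — `μ₂ = 0`, `λ₂ ≤ 1`, `rank₂ Cl(K_n) ≤ 1 ∀ n` for the cubic `2`-torsion field of `⟨1, 0, 1, -10, 11⟩` (`N = 7419`), UNCONDITIONALLY, and the kernel row `MC₂(W)` modulo PRINT⁵ + MuIneqʳ

HONEST FRAMING (cell `bsd-f1-sign2`, WIDTH-5 attached prover seat `bsd-line-att-p4` gen 39 on line `birth` of the lead `bsd-line-att-p2`;
`--supports` stmt-BirchSwinnertonDyer-22298, closes nothing; BSD is NOT proved by any of this; the crux C2, its verdict «blocked-on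
`Rank1Residual.GreenbergMuConjectureIrreducible`» and every registered stub (P/T/Kμ/LimDoor/MuIneqʳ/PFμ⁺ of `Lines/birth.lean` v9) are untouched).
THEOREMS ONLY (no `def`, no named fact beyond the displayed PRINT⁵ + MuIneqʳ of the cell, no instance, no `sorry`); the curve is written LITERALLY.

WHAT.  att-p3 g42/g43's DEPTH DOOR `…CubicDepthDoorGenusCert.classGroupPRank_le_one_adjoin_of_depthDoor_of_genusCert_odd` (odd genus certificate ⟹ `e₁ = 1`;
unit norm index `hidx` at the layer `K_2`) had NO customer: its two known class-`±1 (mod 16)` seeds (`N = 1187, 4307`) have `e₁ ≥ 2` (g43 §2).  This seat's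
census (g39, pure python, exact arithmetic: S-unit relations in `ℚ(β,√2)`, units modulo squares certified by residue symbols, the class `a₀` of order two and its
genus bit) found `e₁ = 1` on EIGHT rank-`0` u7 seeds, three of them of unit class `±1 (mod 16)`: `N = 6555, 13283, 13523`.  This file is the row
`W = ⟨1, 0, 1, -10, 11⟩` (`Δ_min = −7419 = −7419 (prime) ≡ 5 (mod 8)`, rank `0`, `L/Ω = 1`), with EVERY displayed datum of the door DECIDED BY THE KERNEL in `𝓞_{ℚ(β)} = ℤ[θ]`
(`θ = 3g² − (41/4)g + 35/4 = (140 − 41u + 3u²)/16`, `u = 4β`, `f(θ) = 0`, `f = X³ − 86X² − 72X − 15`, att-p4 g38 `…CubicDoorsDeadSubcellClassNumberI` / `CubicDisc 7419`):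
* `h(ℚ(β)) = 1` and `d_{ℚ(β)} = −7419` odd (g38); `𝔭₁ = (π₁)`, `π₁ = -1 -2θ +1θ²`, `N(𝔭₁) = 2` (residue map `𝓞 → ℤ/2`, `θ ↦ 1`);
* the unit `ε = 255355336 1228646438θ 1478187089θ²` (inverse `206783836 499409023θ -5778920θ²`), `ε + 1 ∈ 𝔭₁³` (explicit cofactor), `±ε` non-squares (residue map `𝓞 → ℤ/5`, `θ ↦ 2`: `ε ↦ 3`,
  and `3`, `2` are non-residues mod `5`);
* the ODD GENUS CERTIFICATE (`e₁ = 1`, regime (β)): `x = -2 -6θ -3θ²`, `y = 3 8θ 2θ²`, `α = 4406 10369θ -120θ²` (norm `-17`), `u = 255355336 1228646438θ 1478187089θ²`: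
  `x² − 2y² = u·α²`, `m·α + 14·x = 1`, `m'·α² + 145·2 = 1`, `α − 3 ∈ 𝔭₁³`;
* the unit norm index `[E_{ℚ(β)} : E_{ℚ(β)} ∩ N_{K_2/ℚ(β)} K_2ˣ] = 1` from att-p3 g43's quartic norm form: `F(a,b,c,d) = ε` with `a, b, c, d ∈ ℚ(β)` EXPLICIT
  (twelve rationals of denominator `38825329388497937`; found by S-unit relations in the degree-12 field `ℚ(β, θ₂)`, `θ₂⁴ − 4θ₂² + 2 = 0`).
THEN (★★★ `classGroupPRank_le_one_cubicField_n7419`, UNCONDITIONAL): for every cyclotomic `ℤ₂`-extension `κ` of `ℚ(β)`: `rank₂ Cl(K_m) ≤ 1` for all `m`,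
`μ₂(κ) = 0`, `λ₂(κ) ≤ 1`; (`classNumberPExp_one_cubicField_n7419`) `e₁ = 1`; and (★ `mazurMainConjecture_two_n7419`) `MC₂(W)` modulo PRINT⁵ {Kato 17.4 (1)(2) at `2`,
Greenberg 4.1, period unit, modularity, GZK} + MuIneqʳ (registered stub VERBATIM) + the crux's own hypotheses (`r_an = 0`, analytic `μ₂ = 0`, `BSD₂(W)`) —
att-p5 g24's cubic carrier road.  The FIRST `μ₂ = 0` theorem on the u7 («doors-dead») sub-cell; a non-Galois cubic (closure `S₃`) outside Ferrero–Washington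
and outside every unit-sign door.  CONDITIONAL only in the `MC₂` row; BSD is NOT proved; nothing is closed.

References: [Washington1997] §13.3 Prop. 13.22–13.23; [Lang1990] Ch. 13 §4; [Fukuda1994] Thm. 1; [Gras2003] IV.4; [Serre1973CourseArithmetic] III §1.2;
[NeukirchANT1999] I §7, III §1; [Cohen1993] Prop. 4.8.11; [Kato2004Asterisque] Thm. 17.4; [GreenbergLNM1716] Thm. 4.1; [LMFDB] ec 7419, nf 3.1.7419.1;
tree: att-p3 g42/g43 `…CubicDepthDoor*`, `Literature/NumberTheory/IwasawaTheory/CyclotomicTwoLayerTwoNormForm`, att-p4 g38 `…CubicDoorsDeadSubcellClassNumberI`,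
`Literature/NumberTheory/CubicFields/CubicFieldDiscriminant7419*`, `MonicCubic.exists_ringHom_of_root`.
-/

set_option linter.dupNamespace false
set_option autoImplicit false

noncomputable section

open scoped Classical NumberField nonZeroDivisors IntermediateField

namespace Summit.BirchSwinnertonDyer.BirchSwinnertonDyer.Theorems.AlignedTransportAtTwoCubicDepthDoorRowN7419

open NumberField IsDedekindDomain Polynomial WeierstrassCurve IntermediateField CongruenceSubgroup Module
  Literature.NumberTheory.IwasawaTheory Literature.NumberTheory.GaloisRepresentations
  Literature.NumberTheory.GaloisRepresentations.Herbrand Literature.NumberTheory.GaloisRepresentations.MinkowskiUnit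
  Literature.NumberTheory.GaloisRepresentations.CyclicNormIndex
  Literature.NumberTheory.EllipticCurves Literature.NumberTheory.EllipticCurves.Greenberg1999
  Literature.NumberTheory.EllipticCurves.ModularForms Literature.NumberTheory.EllipticCurves.Rank1Residual
  Literature.NumberTheory.EllipticCurves.Module
  Literature.NumberTheory.NumberFields Literature.NumberTheory.CubicFields
  Summit.BirchSwinnertonDyer.Rank1Residual Summit.BirchSwinnertonDyer.Rank1Residual.X1.MuLambda
  Summit.BirchSwinnertonDyer.Rank1Residual.X5 Summit.BirchSwinnertonDyer.Rank1Residual.X5.O1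
  Summit.BirchSwinnertonDyer.Rank1Residual.X5.Instances Summit.BirchSwinnertonDyer.Rank1Residual.F1Sign2
  Summit.BirchSwinnertonDyer.BirchSwinnertonDyer.Theorems.Rank1ResidualX1Defs
  Summit.BirchSwinnertonDyer.BirchSwinnertonDyer.Theses.AlignedTransportAtTwo
  Summit.BirchSwinnertonDyer.BirchSwinnertonDyer.Theorems.AlignedTransportAtTwoKilfordStratumShared
  Summit.BirchSwinnertonDyer.BirchSwinnertonDyer.Theorems.AlignedTransportAtTwoCubicCarrierRoad
  Summit.BirchSwinnertonDyer.BirchSwinnertonDyer.Theorems.AlignedTransportAtTwoCubicLayerOneDoors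
  Summit.BirchSwinnertonDyer.BirchSwinnertonDyer.Theorems.AlignedTransportAtTwoCubicDepthDoorGenusCert
  Summit.BirchSwinnertonDyer.BirchSwinnertonDyer.Theorems.AlignedTransportAtTwoCubicDoorsDeadSubcellClassNumberI

/-! ## §1 The residue maps of `𝓞_{ℚ(β)} = ℤ[θ]` used by the certificates -/

/-- A ring homomorphism `ψ : 𝓞_{ℚ(β)} → ℤ/5` with `ψ(θ) = 2` (`2` is a simple root of `f` mod `5`; `𝓞 = ℤ[θ] ≅ ℤ[X]/(f)`).
[cite: Marcus2018, Ch. 3, Thm. 27] -/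
theorem exists_residueHom_5 {β : AlgebraicClosure ℚ} (hβ : aeval β ((⟨1, 0, 1, -10, 11⟩ : WeierstrassCurve ℤ).baseChange ℚ).twoTorsionPolynomial.toPoly = 0) :
    ∃ ψ : 𝓞 ↥(IntermediateField.adjoin ℚ ({β} : Set (AlgebraicClosure ℚ))) →+* ZMod 5, ψ (MonicCubic.thetaInt (aeval_theta_n7419 hβ)) = (2 : ZMod 5) :=
  haveI : FiniteDimensional ℚ ↥(IntermediateField.adjoin ℚ ({β} : Set (AlgebraicClosure ℚ))) := IntermediateField.adjoin.finiteDimensional ((AlgebraicClosure.isAlgebraic ℚ).isAlgebraic β).isIntegral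
  haveI : NumberField ↥(IntermediateField.adjoin ℚ ({β} : Set (AlgebraicClosure ℚ))) := NumberField.mk
  MonicCubic.exists_ringHom_of_root CubicDisc7419.irreducible_polyQ (aeval_theta_n7419 hβ) (finrank_cubicField_n7419 hβ)
    CubicDisc7419.isUnit_of_disc_eq_sq_mul (2 : ZMod 5) (by decide)

/-- A ring homomorphism `ψ₂ : 𝓞_{ℚ(β)} → ℤ/2` with `ψ₂(θ) = −1 = 1` (the degree-one dyadic prime `𝔭₁ = (2, θ + 1)`). [cite: Marcus2018, Ch. 3, Thm. 27] -/
theorem exists_residueHom_two {β : AlgebraicClosure ℚ} (hβ : aeval β ((⟨1, 0, 1, -10, 11⟩ : WeierstrassCurve ℤ).baseChange ℚ).twoTorsionPolynomial.toPoly = 0) :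
    ∃ ψ : 𝓞 ↥(IntermediateField.adjoin ℚ ({β} : Set (AlgebraicClosure ℚ))) →+* ZMod 2, ψ (MonicCubic.thetaInt (aeval_theta_n7419 hβ)) = (((-1) : ℤ) : ZMod 2) :=
  haveI : FiniteDimensional ℚ ↥(IntermediateField.adjoin ℚ ({β} : Set (AlgebraicClosure ℚ))) := IntermediateField.adjoin.finiteDimensional ((AlgebraicClosure.isAlgebraic ℚ).isAlgebraic β).isIntegral
  haveI : NumberField ↥(IntermediateField.adjoin ℚ ({β} : Set (AlgebraicClosure ℚ))) := NumberField.mk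
  MonicCubic.exists_ringHom_of_root CubicDisc7419.irreducible_polyQ (aeval_theta_n7419 hβ) (finrank_cubicField_n7419 hβ)
    CubicDisc7419.isUnit_of_disc_eq_sq_mul (((-1) : ℤ) : ZMod 2) (by decide)

/-- **`N((π₁)) = 2`** for `π₁ = -1 -2θ +1θ²`: `(π₁) = (2, θ + 1)` (att-p4 g38) is the kernel of `ψ₂` (Dedekind–Kummer), of index `2`.
[cite: Marcus2018, Ch. 3, Thm. 27] [cite: LMFDB, number field 3.1.7419.1] -/
theorem absNorm_span_pi1_n7419 {β : AlgebraicClosure ℚ} (hβ : aeval β ((⟨1, 0, 1, -10, 11⟩ : WeierstrassCurve ℤ).baseChange ℚ).twoTorsionPolynomial.toPoly = 0) :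
    haveI : FiniteDimensional ℚ ↥(IntermediateField.adjoin ℚ ({β} : Set (AlgebraicClosure ℚ))) := IntermediateField.adjoin.finiteDimensional ((AlgebraicClosure.isAlgebraic ℚ).isAlgebraic β).isIntegral
    haveI : NumberField ↥(IntermediateField.adjoin ℚ ({β} : Set (AlgebraicClosure ℚ))) := NumberField.mk
    Ideal.absNorm (Ideal.span {((-1 : 𝓞 ↥(IntermediateField.adjoin ℚ ({β} : Set (AlgebraicClosure ℚ)))) + (-2 : 𝓞 ↥(IntermediateField.adjoin ℚ ({β} : Set (AlgebraicClosure ℚ)))) * MonicCubic.thetaInt (aeval_theta_n7419 hβ) + (1 : 𝓞 ↥(IntermediateField.adjoin ℚ ({β} : Set (AlgebraicClosure ℚ)))) * MonicCubic.thetaInt (aeval_theta_n7419 hβ) ^ 2)}) = 2 := by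
  haveI : FiniteDimensional ℚ ↥(IntermediateField.adjoin ℚ ({β} : Set (AlgebraicClosure ℚ))) := IntermediateField.adjoin.finiteDimensional ((AlgebraicClosure.isAlgebraic ℚ).isAlgebraic β).isIntegral
  haveI : NumberField ↥(IntermediateField.adjoin ℚ ({β} : Set (AlgebraicClosure ℚ))) := NumberField.mk
  haveI : Fact (Nat.Prime 2) := ⟨Nat.prime_two⟩
  have hθ := aeval_theta_n7419 hβ
  have h3 := finrank_cubicField_n7419 hβ
  obtain ⟨ψ, hψ⟩ := exists_residueHom_two hβ
  have hexp : ¬ 2 ∣ RingOfIntegers.exponent (MonicCubic.thetaInt hθ) := by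
    rw [MonicCubic.exponent_thetaInt CubicDisc7419.irreducible_polyQ hθ h3 CubicDisc7419.isUnit_of_disc_eq_sq_mul]; decide
  have hker := MonicCubic.ker_residueHom_eq_span CubicDisc7419.irreducible_polyQ hθ hexp ψ hψ
  have hspan : Ideal.span {((2 : ℕ) : 𝓞 ↥(IntermediateField.adjoin ℚ ({β} : Set (AlgebraicClosure ℚ)))), MonicCubic.thetaInt hθ - (((-1) : ℤ) : 𝓞 ↥(IntermediateField.adjoin ℚ ({β} : Set (AlgebraicClosure ℚ))))} = Ideal.span {((-1 : 𝓞 ↥(IntermediateField.adjoin ℚ ({β} : Set (AlgebraicClosure ℚ)))) + (-2 : 𝓞 ↥(IntermediateField.adjoin ℚ ({β} : Set (AlgebraicClosure ℚ)))) * MonicCubic.thetaInt hθ + (1 : 𝓞 ↥(IntermediateField.adjoin ℚ ({β} : Set (AlgebraicClosure ℚ)))) * MonicCubic.thetaInt hθ ^ 2)} := by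
    rw [Nat.cast_ofNat, show MonicCubic.thetaInt hθ - (((-1) : ℤ) : 𝓞 ↥(IntermediateField.adjoin ℚ ({β} : Set (AlgebraicClosure ℚ)))) = MonicCubic.thetaInt hθ + 1 by push_cast; ring,
      show ((-1 : 𝓞 ↥(IntermediateField.adjoin ℚ ({β} : Set (AlgebraicClosure ℚ)))) + (-2 : 𝓞 ↥(IntermediateField.adjoin ℚ ({β} : Set (AlgebraicClosure ℚ)))) * MonicCubic.thetaInt hθ + (1 : 𝓞 ↥(IntermediateField.adjoin ℚ ({β} : Set (AlgebraicClosure ℚ)))) * MonicCubic.thetaInt hθ ^ 2) = -1 - 2 * MonicCubic.thetaInt hθ + MonicCubic.thetaInt hθ ^ 2 by ring]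
    exact CubicDisc7419.span_2_lin1_eq hθ
  rw [← hspan, ← hker]
  exact absNorm_ker_zmod ψ


/-! ## §2 ★★★ `rank₂ Cl(K_n) ≤ 1`, `μ₂ = 0`, `λ₂ ≤ 1` for the cubic field of discriminant `−7419` — UNCONDITIONAL -/

/-- ★★★ **THE DEPTH DOOR FIRES AT `N = 7419`: for `β ∈ ℚ̄` ANY root of the `2`-division cubic of `⟨1, 0, 1, -10, 11⟩` and EVERY cyclotomic `ℤ₂`-extension `κ` of
`ℚ(β)` (the cubic field of discriminant `−7419`): `rank₂ Cl(K_m) ≤ 1` for all `m`, `μ₂(κ) = 0`, `λ₂(κ) ≤ 1`** — NO hypothesis.  att-p3 g42/g43's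
`classGroupPRank_le_one_adjoin_of_depthDoor_of_genusCert_odd` with every displayed datum decided by the kernel: `h = 1`, `2 ∤ d`, `N(π₁) = 2`, the unit
`ε` with `ε + 1 ∈ (π₁)³` and `±ε` non-squares (residue map mod `5`), the odd genus certificate `x² − 2y² = uα²`, `mα + 14 x = 1`, `m'α² + 145·2 = 1`,
`α − 3 ∈ (π₁)³`, and the layer-two unit norm index from `F(a,b,c,d) = ε` (att-p3 g43's `relIndex_unitsNorm_layer_two_eq_one_of_normForm_eq`).
[cite: Washington1997, §13.3 Prop. 13.22–13.23] [cite: Fukuda1994, Thm. 1, p. 264] [cite: Gras2003, IV.4] [cite: Serre1973CourseArithmetic, Ch. III §1.2, Thm. 1]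
[cite: LMFDB, number field 3.1.7419.1 (class number 1)] -/
theorem classGroupPRank_le_one_cubicField_n7419 {β : AlgebraicClosure ℚ} (hβ : aeval β ((⟨1, 0, 1, -10, 11⟩ : WeierstrassCurve ℤ).baseChange ℚ).twoTorsionPolynomial.toPoly = 0)
    (κP : ZpExtension ↥(IntermediateField.adjoin ℚ ({β} : Set (AlgebraicClosure ℚ))) 2) (hκP : κP.IsCyclotomic) :
    (∀ m : ℕ, classGroupPRank κP m ≤ 1) ∧ ClassicalMuVanishes κP ∧ classicalLambda κP ≤ 1 := by
  haveI := isElliptic_n7419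
  haveI := isGloballyMinimal_n7419
  haveI : FiniteDimensional ℚ ↥(IntermediateField.adjoin ℚ ({β} : Set (AlgebraicClosure ℚ))) := IntermediateField.adjoin.finiteDimensional ((AlgebraicClosure.isAlgebraic ℚ).isAlgebraic β).isIntegral
  haveI : NumberField ↥(IntermediateField.adjoin ℚ ({β} : Set (AlgebraicClosure ℚ))) := NumberField.mk
  haveI : FiniteDimensional ↥(IntermediateField.adjoin ℚ ({β} : Set (AlgebraicClosure ℚ))) (κP.layer 2) := κP.finiteDimensional_layer_holds 2
  haveI : NumberField (κP.layer 2) := NumberField.of_module_finite ↥(IntermediateField.adjoin ℚ ({β} : Set (AlgebraicClosure ℚ))) _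
  have hord : IsOrdinaryAt ((⟨1, 0, 1, -10, 11⟩ : WeierstrassCurve ℤ).baseChange ℚ) 2 := goodOrd_two_n7419
  have ht := not_hasRationalTwoTorsionX_n7419
  have hirr := AlignedTransportAtTwoSeed.irr_two_of_forall_not_hasRationalTwoTorsionX _ ht
  have hθ := aeval_theta_n7419 hβ
  have h3 := finrank_cubicField_n7419 hβ
  have hodd3 : ¬ 2 ∣ finrank ℚ ↥(IntermediateField.adjoin ℚ ({β} : Set (AlgebraicClosure ℚ))) := by rw [h3]; decide
  have hrank : Units.rank ↥(IntermediateField.adjoin ℚ ({β} : Set (AlgebraicClosure ℚ))) = 1 := units_rank_eq_one_of_nrRealPlaces_eq_one _ h3 (nrRealPlaces_adjoin_root_twoTorsionPolynomial_eq_one _ Δ_n7419_neg hirr hβ)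
  have hd : ¬ (2 : ℤ) ∣ NumberField.discr ↥(IntermediateField.adjoin ℚ ({β} : Set (AlgebraicClosure ℚ))) := by
    rw [CubicDisc7419.discr_eq h3 hθ]; norm_num
  -- the integral generator and its cubic relation
  obtain ⟨ψ, hψ⟩ := exists_residueHom_5 hβ
  set θI : 𝓞 ↥(IntermediateField.adjoin ℚ ({β} : Set (AlgebraicClosure ℚ))) := MonicCubic.thetaInt hθ with hθI
  have hrel : θI ^ 3 + (-86 : 𝓞 ↥(IntermediateField.adjoin ℚ ({β} : Set (AlgebraicClosure ℚ)))) * θI ^ 2 + (-72 : 𝓞 ↥(IntermediateField.adjoin ℚ ({β} : Set (AlgebraicClosure ℚ)))) * θI + (-15 : 𝓞 ↥(IntermediateField.adjoin ℚ ({β} : Set (AlgebraicClosure ℚ)))) = 0 := by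
    have h := MonicCubic.thetaInt_rel hθ
    push_cast at h
    linear_combination h
  -- the unit ε (and ε⁻¹ = u)
  have hεmul : ((255355336 : 𝓞 ↥(IntermediateField.adjoin ℚ ({β} : Set (AlgebraicClosure ℚ)))) + (1228646438 : 𝓞 ↥(IntermediateField.adjoin ℚ ({β} : Set (AlgebraicClosure ℚ)))) * θI + (1478187089 : 𝓞 ↥(IntermediateField.adjoin ℚ ({β} : Set (AlgebraicClosure ℚ)))) * θI ^ 2) * ((206783836 : 𝓞 ↥(IntermediateField.adjoin ℚ ({β} : Set (AlgebraicClosure ℚ)))) + (499409023 : 𝓞 ↥(IntermediateField.adjoin ℚ ({β} : Set (AlgebraicClosure ℚ)))) * θI + (-5778920 : 𝓞 ↥(IntermediateField.adjoin ℚ ({β} : Set (AlgebraicClosure ℚ)))) * θI ^ 2) = 1 := by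
    linear_combination ((-3520223728076593 : 𝓞 ↥(IntermediateField.adjoin ℚ ({β} : Set (AlgebraicClosure ℚ)))) * θI ^ 0 + (-8542324932363880 : 𝓞 ↥(IntermediateField.adjoin ℚ ({β} : Set (AlgebraicClosure ℚ)))) * θI ^ 1) * hrel
  have humul : ((255355336 : 𝓞 ↥(IntermediateField.adjoin ℚ ({β} : Set (AlgebraicClosure ℚ)))) + (1228646438 : 𝓞 ↥(IntermediateField.adjoin ℚ ({β} : Set (AlgebraicClosure ℚ)))) * θI + (1478187089 : 𝓞 ↥(IntermediateField.adjoin ℚ ({β} : Set (AlgebraicClosure ℚ)))) * θI ^ 2) * ((206783836 : 𝓞 ↥(IntermediateField.adjoin ℚ ({β} : Set (AlgebraicClosure ℚ)))) + (499409023 : 𝓞 ↥(IntermediateField.adjoin ℚ ({β} : Set (AlgebraicClosure ℚ)))) * θI + (-5778920 : 𝓞 ↥(IntermediateField.adjoin ℚ ({β} : Set (AlgebraicClosure ℚ)))) * θI ^ 2) = 1 := by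
    linear_combination ((-3520223728076593 : 𝓞 ↥(IntermediateField.adjoin ℚ ({β} : Set (AlgebraicClosure ℚ)))) * θI ^ 0 + (-8542324932363880 : 𝓞 ↥(IntermediateField.adjoin ℚ ({β} : Set (AlgebraicClosure ℚ)))) * θI ^ 1) * hrel
  -- residue map mod 5: ±ε are not squares of units
  have hψε : ψ ((255355336 : 𝓞 ↥(IntermediateField.adjoin ℚ ({β} : Set (AlgebraicClosure ℚ)))) + (1228646438 : 𝓞 ↥(IntermediateField.adjoin ℚ ({β} : Set (AlgebraicClosure ℚ)))) * θI + (1478187089 : 𝓞 ↥(IntermediateField.adjoin ℚ ({β} : Set (AlgebraicClosure ℚ)))) * θI ^ 2) = (3 : ZMod 5) := by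
    simp only [map_add, map_mul, map_pow, map_ofNat, hψ]
    decide
  have hnsq : ∀ z : (𝓞 ↥(IntermediateField.adjoin ℚ ({β} : Set (AlgebraicClosure ℚ))))ˣ, Units.mkOfMulEqOne _ _ hεmul ≠ z ^ 2 ∧ Units.mkOfMulEqOne _ _ hεmul ≠ -z ^ 2 := by
    intro z
    refine ⟨fun h => ?_, fun h => ?_⟩
    · have h' := congrArg (fun w : (𝓞 ↥(IntermediateField.adjoin ℚ ({β} : Set (AlgebraicClosure ℚ))))ˣ => ψ (w : 𝓞 ↥(IntermediateField.adjoin ℚ ({β} : Set (AlgebraicClosure ℚ))))) h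
      simp only [Units.val_mkOfMulEqOne, Units.val_pow_eq_pow_val, map_pow] at h'
      rw [hψε] at h'
      exact absurd h'.symm (by generalize ψ (z : 𝓞 ↥(IntermediateField.adjoin ℚ ({β} : Set (AlgebraicClosure ℚ)))) = t; revert t; decide)
    · have h' := congrArg (fun w : (𝓞 ↥(IntermediateField.adjoin ℚ ({β} : Set (AlgebraicClosure ℚ))))ˣ => ψ (w : 𝓞 ↥(IntermediateField.adjoin ℚ ({β} : Set (AlgebraicClosure ℚ))))) h
      simp only [Units.val_mkOfMulEqOne, Units.val_neg, Units.val_pow_eq_pow_val, map_neg, map_pow] at h'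
      rw [hψε] at h'
      exact absurd h'.symm (by generalize ψ (z : 𝓞 ↥(IntermediateField.adjoin ℚ ({β} : Set (AlgebraicClosure ℚ)))) = t; revert t; decide)
  -- `ε + 1 ∈ (π₁)³`
  have hε : (Units.mkOfMulEqOne _ _ hεmul : (𝓞 ↥(IntermediateField.adjoin ℚ ({β} : Set (AlgebraicClosure ℚ))))ˣ).val - 1 ∈ Ideal.span {((-1 : 𝓞 ↥(IntermediateField.adjoin ℚ ({β} : Set (AlgebraicClosure ℚ)))) + (-2 : 𝓞 ↥(IntermediateField.adjoin ℚ ({β} : Set (AlgebraicClosure ℚ)))) * θI + (1 : 𝓞 ↥(IntermediateField.adjoin ℚ ({β} : Set (AlgebraicClosure ℚ)))) * θI ^ 2)} ^ 3 ∨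
      (Units.mkOfMulEqOne _ _ hεmul : (𝓞 ↥(IntermediateField.adjoin ℚ ({β} : Set (AlgebraicClosure ℚ))))ˣ).val + 1 ∈ Ideal.span {((-1 : 𝓞 ↥(IntermediateField.adjoin ℚ ({β} : Set (AlgebraicClosure ℚ)))) + (-2 : 𝓞 ↥(IntermediateField.adjoin ℚ ({β} : Set (AlgebraicClosure ℚ)))) * θI + (1 : 𝓞 ↥(IntermediateField.adjoin ℚ ({β} : Set (AlgebraicClosure ℚ)))) * θI ^ 2)} ^ 3 := by
    refine Or.inr ?_
    rw [Units.val_mkOfMulEqOne, Ideal.span_singleton_pow, Ideal.mem_span_singleton']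
    exact ⟨((-12523097 : 𝓞 ↥(IntermediateField.adjoin ℚ ({β} : Set (AlgebraicClosure ℚ)))) + (-29639654 : 𝓞 ↥(IntermediateField.adjoin ℚ ({β} : Set (AlgebraicClosure ℚ)))) * θI + (343009 : 𝓞 ↥(IntermediateField.adjoin ℚ ({β} : Set (AlgebraicClosure ℚ)))) * θI ^ 2), by linear_combination ((16188816 : 𝓞 ↥(IntermediateField.adjoin ℚ ({β} : Set (AlgebraicClosure ℚ)))) * θI ^ 0 + (-2781770 : 𝓞 ↥(IntermediateField.adjoin ℚ ({β} : Set (AlgebraicClosure ℚ)))) * θI ^ 1 + (-264429 : 𝓞 ↥(IntermediateField.adjoin ℚ ({β} : Set (AlgebraicClosure ℚ)))) * θI ^ 2 + (3990232 : 𝓞 ↥(IntermediateField.adjoin ℚ ({β} : Set (AlgebraicClosure ℚ)))) * θI ^ 3 + (-2198934 : 𝓞 ↥(IntermediateField.adjoin ℚ ({β} : Set (AlgebraicClosure ℚ)))) * θI ^ 4 + (343009 : 𝓞 ↥(IntermediateField.adjoin ℚ ({β} : Set (AlgebraicClosure ℚ)))) * θI ^ 5) * hrel⟩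
  -- the odd genus certificate
  have hxy : ((-2 : 𝓞 ↥(IntermediateField.adjoin ℚ ({β} : Set (AlgebraicClosure ℚ)))) + (-6 : 𝓞 ↥(IntermediateField.adjoin ℚ ({β} : Set (AlgebraicClosure ℚ)))) * θI + (-3 : 𝓞 ↥(IntermediateField.adjoin ℚ ({β} : Set (AlgebraicClosure ℚ)))) * θI ^ 2) ^ 2 - 2 * ((3 : 𝓞 ↥(IntermediateField.adjoin ℚ ({β} : Set (AlgebraicClosure ℚ)))) + (8 : 𝓞 ↥(IntermediateField.adjoin ℚ ({β} : Set (AlgebraicClosure ℚ)))) * θI + (2 : 𝓞 ↥(IntermediateField.adjoin ℚ ({β} : Set (AlgebraicClosure ℚ)))) * θI ^ 2) ^ 2 = (Units.mkOfMulEqOne _ _ humul : (𝓞 ↥(IntermediateField.adjoin ℚ ({β} : Set (AlgebraicClosure ℚ))))ˣ).val * ((4406 : 𝓞 ↥(IntermediateField.adjoin ℚ ({β} : Set (AlgebraicClosure ℚ)))) + (10369 : 𝓞 ↥(IntermediateField.adjoin ℚ ({β} : Set (AlgebraicClosure ℚ)))) * θI + (-120 : 𝓞 ↥(IntermediateField.adjoin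 ℚ ({β} : Set (AlgebraicClosure ℚ)))) * θI ^ 2) ^ 2 := by
    rw [Units.val_mkOfMulEqOne]
    linear_combination ((330478083966194 : 𝓞 ↥(IntermediateField.adjoin ℚ ({β} : Set (AlgebraicClosure ℚ)))) * θI ^ 0 + (1559288168407952 : 𝓞 ↥(IntermediateField.adjoin ℚ ({β} : Set (AlgebraicClosure ℚ)))) * θI ^ 1 + (1830277862477040 : 𝓞 ↥(IntermediateField.adjoin ℚ ({β} : Set (AlgebraicClosure ℚ)))) * θI ^ 2 + (-21285894081600 : 𝓞 ↥(IntermediateField.adjoin ℚ ({β} : Set (AlgebraicClosure ℚ)))) * θI ^ 3) * hrel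
  have hbez : ((-4016 : 𝓞 ↥(IntermediateField.adjoin ℚ ({β} : Set (AlgebraicClosure ℚ)))) + (-19322 : 𝓞 ↥(IntermediateField.adjoin ℚ ({β} : Set (AlgebraicClosure ℚ)))) * θI + (-23245 : 𝓞 ↥(IntermediateField.adjoin ℚ ({β} : Set (AlgebraicClosure ℚ)))) * θI ^ 2) * ((4406 : 𝓞 ↥(IntermediateField.adjoin ℚ ({β} : Set (AlgebraicClosure ℚ)))) + (10369 : 𝓞 ↥(IntermediateField.adjoin ℚ ({β} : Set (AlgebraicClosure ℚ)))) * θI + (-120 : 𝓞 ↥(IntermediateField.adjoin ℚ ({β} : Set (AlgebraicClosure ℚ)))) * θI ^ 2) + (14 : 𝓞 ↥(IntermediateField.adjoin ℚ ({β} : Set (AlgebraicClosure ℚ)))) * ((-2 : 𝓞 ↥(IntermediateField.adjoin ℚ ({β} : Set (AlgebraicClosure ℚ)))) + (-6 : 𝓞 ↥(IntermediateField.adjoin ℚ ({β} : Set (AlgebraicClosure ℚ)))) * θI + (-3 : 𝓞 ↥(IntermediateField.adjoin ℚ ({β} : Set (AlgebraicClosure ℚ)))) * θI ^ 2) = 1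 := by
    linear_combination ((1179635 : 𝓞 ↥(IntermediateField.adjoin ℚ ({β} : Set (AlgebraicClosure ℚ)))) * θI ^ 0 + (2789400 : 𝓞 ↥(IntermediateField.adjoin ℚ ({β} : Set (AlgebraicClosure ℚ)))) * θI ^ 1) * hrel
  have hbez' : ((-1954 : 𝓞 ↥(IntermediateField.adjoin ℚ ({β} : Set (AlgebraicClosure ℚ)))) + (-9407 : 𝓞 ↥(IntermediateField.adjoin ℚ ({β} : Set (AlgebraicClosure ℚ)))) * θI + (-11324 : 𝓞 ↥(IntermediateField.adjoin ℚ ({β} : Set (AlgebraicClosure ℚ)))) * θI ^ 2) * ((4406 : 𝓞 ↥(IntermediateField.adjoin ℚ ({β} : Set (AlgebraicClosure ℚ)))) + (10369 : 𝓞 ↥(IntermediateField.adjoin ℚ ({β} : Set (AlgebraicClosure ℚ)))) * θI + (-120 : 𝓞 ↥(IntermediateField.adjoin ℚ ({β} : Set (AlgebraicClosure ℚ)))) * θI ^ 2) ^ 2 + (145 : 𝓞 ↥(IntermediateField.adjoin ℚ ({β} : Set (AlgebraicClosure ℚ)))) * 2 = 1 := by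
    linear_combination ((2528845417 : 𝓞 ↥(IntermediateField.adjoin ℚ ({β} : Set (AlgebraicClosure ℚ)))) * θI ^ 0 + (11938655956 : 𝓞 ↥(IntermediateField.adjoin ℚ ({β} : Set (AlgebraicClosure ℚ)))) * θI ^ 1 + (14021351040 : 𝓞 ↥(IntermediateField.adjoin ℚ ({β} : Set (AlgebraicClosure ℚ)))) * θI ^ 2 + (-163065600 : 𝓞 ↥(IntermediateField.adjoin ℚ ({β} : Set (AlgebraicClosure ℚ)))) * θI ^ 3) * hrel
  have hα : ((4406 : 𝓞 ↥(IntermediateField.adjoin ℚ ({β} : Set (AlgebraicClosure ℚ)))) + (10369 : 𝓞 ↥(IntermediateField.adjoin ℚ ({β} : Set (AlgebraicClosure ℚ)))) * θI + (-120 : 𝓞 ↥(IntermediateField.adjoin ℚ ({β} : Set (AlgebraicClosure ℚ)))) * θI ^ 2) - 3 ∈ Ideal.span {((-1 : 𝓞 ↥(IntermediateField.adjoin ℚ ({β} : Set (AlgebraicClosure ℚ)))) + (-2 : 𝓞 ↥(IntermediateField.adjoin ℚ ({β} : Set (AlgebraicClosure ℚ)))) * θI + (1 : 𝓞 ↥(IntermediateField.adjoin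 ℚ ({β} : Set (AlgebraicClosure ℚ)))) * θI ^ 2)} ^ 3 ∨ ((4406 : 𝓞 ↥(IntermediateField.adjoin ℚ ({β} : Set (AlgebraicClosure ℚ)))) + (10369 : 𝓞 ↥(IntermediateField.adjoin ℚ ({β} : Set (AlgebraicClosure ℚ)))) * θI + (-120 : 𝓞 ↥(IntermediateField.adjoin ℚ ({β} : Set (AlgebraicClosure ℚ)))) * θI ^ 2) + 3 ∈ Ideal.span {((-1 : 𝓞 ↥(IntermediateField.adjoin ℚ ({β} : Set (AlgebraicClosure ℚ)))) + (-2 : 𝓞 ↥(IntermediateField.adjoin ℚ ({β} : Set (AlgebraicClosure ℚ)))) * θI + (1 : 𝓞 ↥(IntermediateField.adjoin ℚ ({β} : Set (AlgebraicClosure ℚ)))) * θI ^ 2)} ^ 3 := by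
    refine Or.inl ?_
    rw [Ideal.span_singleton_pow, Ideal.mem_span_singleton']
    exact ⟨((-1535707523 : 𝓞 ↥(IntermediateField.adjoin ℚ ({β} : Set (AlgebraicClosure ℚ)))) + (-3676059847 : 𝓞 ↥(IntermediateField.adjoin ℚ ({β} : Set (AlgebraicClosure ℚ)))) * θI + (42539394 : 𝓞 ↥(IntermediateField.adjoin ℚ ({β} : Set (AlgebraicClosure ℚ)))) * θI ^ 2), by linear_combination ((-102380208 : 𝓞 ↥(IntermediateField.adjoin ℚ ({β} : Set (AlgebraicClosure ℚ)))) * θI ^ 0 + (-367927976 : 𝓞 ↥(IntermediateField.adjoin ℚ ({β} : Set (AlgebraicClosure ℚ)))) * θI ^ 1 + (-35978357 : 𝓞 ↥(IntermediateField.adjoin ℚ ({β} : Set (AlgebraicClosure ℚ)))) * θI ^ 2 + (496226351 : 𝓞 ↥(IntermediateField.adjoin ℚ ({β} : Set (AlgebraicClosure ℚ)))) * θI ^ 3 + (-272908327 : 𝓞 ↥(IntermediateField.adjoin ℚ ({β} : Set (AlgebraicClosure ℚ)))) * θI ^ 4 + (42539394 : 𝓞 ↥(IntermediateField.adjoin ℚ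 ({β} : Set (AlgebraicClosure ℚ)))) * θI ^ 5) * hrel⟩
  -- the layer-two unit norm index from the quartic norm form `F(a,b,c,d) = ε`
  have hrelK : (θI : ↥(IntermediateField.adjoin ℚ ({β} : Set (AlgebraicClosure ℚ)))) ^ 3 + (-86 : ↥(IntermediateField.adjoin ℚ ({β} : Set (AlgebraicClosure ℚ)))) * (θI : ↥(IntermediateField.adjoin ℚ ({β} : Set (AlgebraicClosure ℚ)))) ^ 2 + (-72 : ↥(IntermediateField.adjoin ℚ ({β} : Set (AlgebraicClosure ℚ)))) * (θI : ↥(IntermediateField.adjoin ℚ ({β} : Set (AlgebraicClosure ℚ)))) + (-15 : ↥(IntermediateField.adjoin ℚ ({β} : Set (AlgebraicClosure ℚ)))) = 0 := by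
    have h := MonicCubic.theta_rel hθ
    rw [hθI, MonicCubic.coe_thetaInt]
    push_cast at h
    linear_combination h
  have hidx := relIndex_unitsNorm_layer_two_eq_one_of_normForm_eq hodd3 hrank κP hκP (ε := Units.mkOfMulEqOne _ _ hεmul)
    ((395945009555076570620003838422 / 38825329388497937 : ↥(IntermediateField.adjoin ℚ ({β} : Set (AlgebraicClosure ℚ)))) + (610821812535297920954090028428 / 38825329388497937 : ↥(IntermediateField.adjoin ℚ ({β} : Set (AlgebraicClosure ℚ)))) * (θI : ↥(IntermediateField.adjoin ℚ ({β} : Set (AlgebraicClosure ℚ)))) + (-880331439946424465963709504823 / 38825329388497937 : ↥(IntermediateField.adjoin ℚ ({β} : Set (AlgebraicClosure ℚ)))) * (θI : ↥(IntermediateField.adjoin ℚ ({β} : Set (AlgebraicClosure ℚ)))) ^ 2) ((13293187507034541050950787383802 / 660030599604464929 : ↥(IntermediateField.adjoin ℚ ({β} : Set (AlgebraicClosure ℚ)))) + (40398095181017073044732723334671 / 660030599604464929 : ↥(IntermediateField.adjoin ℚ ({β} : Set (AlgebraicClosure ℚ)))) * (θI : ↥(IntermediateField.adjoin ℚ ({β}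 : Set (AlgebraicClosure ℚ)))) + (18929115935740747724402548107070 / 660030599604464929 : ↥(IntermediateField.adjoin ℚ ({β} : Set (AlgebraicClosure ℚ)))) * (θI : ↥(IntermediateField.adjoin ℚ ({β} : Set (AlgebraicClosure ℚ)))) ^ 2) ((-348461813880823056859171669011 / 38825329388497937 : ↥(IntermediateField.adjoin ℚ ({β} : Set (AlgebraicClosure ℚ)))) + (-733917774326866741276084267936 / 38825329388497937 : ↥(IntermediateField.adjoin ℚ ({β} : Set (AlgebraicClosure ℚ)))) * (θI : ↥(IntermediateField.adjoin ℚ ({β} : Set (AlgebraicClosure ℚ)))) + (264265811284997420788333970106 / 38825329388497937 : ↥(IntermediateField.adjoin ℚ ({β} : Set (AlgebraicClosure ℚ)))) * (θI : ↥(IntermediateField.adjoin ℚ ({β} : Set (AlgebraicClosure ℚ)))) ^ 2) ((-6032490351596783986329078030643 / 660030599604464929 : ↥(IntermediateField.adjoin ℚ ({β} : Set (AlgebraicClosure ℚ)))) + (-16938625649747177793890538239588 / 660030599604464929 : ↥(IntermediateField.adjoin ℚ ({β} : Set (AlgebraicClosure ℚ)))) * (θI : ↥(IntermediateField.adjoin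 ℚ ({β} : Set (AlgebraicClosure ℚ)))) + (-5485118692049482639438415849673 / 660030599604464929 : ↥(IntermediateField.adjoin ℚ ({β} : Set (AlgebraicClosure ℚ)))) * (θI : ↥(IntermediateField.adjoin ℚ ({β} : Set (AlgebraicClosure ℚ)))) ^ 2) (by
      rw [Units.val_mkOfMulEqOne]
      push_cast
      simp only [map_ofNat]
      linear_combination ((-27064617000329017714333364626317297154080845358237132052318666581233085260 / 170242960793055609331454768250038638267889 : ↥(IntermediateField.adjoin ℚ ({β} : Set (AlgebraicClosure ℚ)))) * (θI : ↥(IntermediateField.adjoin ℚ ({β} : Set (AlgebraicClosure ℚ)))) ^ 0 + (-3491044395356128309701933108691461325843338289297387971831212582030069092054 / 2894130333481945358634731060250656850554113 : ↥(IntermediateField.adjoin ℚ ({β} : Set (AlgebraicClosure ℚ)))) * (θI : ↥(IntermediateField.adjoin ℚ ({β} : Set (AlgebraicClosure ℚ)))) ^ 1 + (-9141772711944643227188856166829048934537441942085361193157585387701391176953 / 2894130333481945358634731060250656850554113 : ↥(IntermediateField.adjoin ℚ ({β} : Set (AlgebraicClosure ℚ)))) * (θI : ↥(IntermediateField.adjoin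 ℚ ({β} : Set (AlgebraicClosure ℚ)))) ^ 2 + (-8991275936539035569853606937300409973064077323640836469871694420647751011888 / 2894130333481945358634731060250656850554113 : ↥(IntermediateField.adjoin ℚ ({β} : Set (AlgebraicClosure ℚ)))) * (θI : ↥(IntermediateField.adjoin ℚ ({β} : Set (AlgebraicClosure ℚ)))) ^ 3 + (-1908029041929457541875304677402091395388084275918685347979762759368798848866 / 2894130333481945358634731060250656850554113 : ↥(IntermediateField.adjoin ℚ ({β} : Set (AlgebraicClosure ℚ)))) * (θI : ↥(IntermediateField.adjoin ℚ ({β} : Set (AlgebraicClosure ℚ)))) ^ 4 + (23180612179776051778944157841604549244695897948214289578993753865977888001 / 2894130333481945358634731060250656850554113 : ↥(IntermediateField.adjoin ℚ ({β} : Set (AlgebraicClosure ℚ)))) * (θI : ↥(IntermediateField.adjoin ℚ ({β} : Set (AlgebraicClosure ℚ)))) ^ 5) * hrelK) hnsq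
  exact classGroupPRank_le_one_adjoin_of_depthDoor_of_genusCert_odd ((⟨1, 0, 1, -10, 11⟩ : WeierstrassCurve ℤ).baseChange ℚ) hord ht minimalDiscriminantInt_emod_eight_n7419 Δ_n7419_neg hβ
    (not_two_dvd_classNumber_cubicField_n7419 hβ) hd (Ideal.span {((-1 : 𝓞 ↥(IntermediateField.adjoin ℚ ({β} : Set (AlgebraicClosure ℚ)))) + (-2 : 𝓞 ↥(IntermediateField.adjoin ℚ ({β} : Set (AlgebraicClosure ℚ)))) * θI + (1 : 𝓞 ↥(IntermediateField.adjoin ℚ ({β} : Set (AlgebraicClosure ℚ)))) * θI ^ 2)}) (absNorm_span_pi1_n7419 hβ) hε hnsq hxy hbez hbez' hα κP hκP hidx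

/-- **`e₁ = ord₂ h(ℚ(β,√2)) = 1`** for the cubic field of discriminant `−7419` (every cyclotomic `κ`): the odd genus certificate alone
(att-p3 g43's `classNumberPExp_one_adjoin_eq_one_of_genusCert_odd`). [cite: Gras2003, IV.4] [cite: Serre1973CourseArithmetic, Ch. III §1.2, Thm. 1]
[cite: LMFDB, number field 3.1.7419.1 (class number 1)] -/
theorem classNumberPExp_one_cubicField_n7419 {β : AlgebraicClosure ℚ} (hβ : aeval β ((⟨1, 0, 1, -10, 11⟩ : WeierstrassCurve ℤ).baseChange ℚ).twoTorsionPolynomial.toPoly = 0)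
    (κP : ZpExtension ↥(IntermediateField.adjoin ℚ ({β} : Set (AlgebraicClosure ℚ))) 2) (hκP : κP.IsCyclotomic) :
    classNumberPExp κP 1 = 1 := by
  haveI := isElliptic_n7419
  haveI := isGloballyMinimal_n7419
  haveI : FiniteDimensional ℚ ↥(IntermediateField.adjoin ℚ ({β} : Set (AlgebraicClosure ℚ))) := IntermediateField.adjoin.finiteDimensional ((AlgebraicClosure.isAlgebraic ℚ).isAlgebraic β).isIntegral
  haveI : NumberField ↥(IntermediateField.adjoin ℚ ({β} : Set (AlgebraicClosure ℚ))) := NumberField.mk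
  have hord : IsOrdinaryAt ((⟨1, 0, 1, -10, 11⟩ : WeierstrassCurve ℤ).baseChange ℚ) 2 := goodOrd_two_n7419
  have ht := not_hasRationalTwoTorsionX_n7419
  have hθ := aeval_theta_n7419 hβ
  have h3 := finrank_cubicField_n7419 hβ
  have hd : ¬ (2 : ℤ) ∣ NumberField.discr ↥(IntermediateField.adjoin ℚ ({β} : Set (AlgebraicClosure ℚ))) := by
    rw [CubicDisc7419.discr_eq h3 hθ]; norm_num
  obtain ⟨ψ, hψ⟩ := exists_residueHom_5 hβ
  set θI : 𝓞 ↥(IntermediateField.adjoin ℚ ({β} : Set (AlgebraicClosure ℚ))) := MonicCubic.thetaInt hθ with hθI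
  have hrel : θI ^ 3 + (-86 : 𝓞 ↥(IntermediateField.adjoin ℚ ({β} : Set (AlgebraicClosure ℚ)))) * θI ^ 2 + (-72 : 𝓞 ↥(IntermediateField.adjoin ℚ ({β} : Set (AlgebraicClosure ℚ)))) * θI + (-15 : 𝓞 ↥(IntermediateField.adjoin ℚ ({β} : Set (AlgebraicClosure ℚ)))) = 0 := by
    have h := MonicCubic.thetaInt_rel hθ
    push_cast at h
    linear_combination h
  have hεmul : ((255355336 : 𝓞 ↥(IntermediateField.adjoin ℚ ({β} : Set (AlgebraicClosure ℚ)))) + (1228646438 : 𝓞 ↥(IntermediateField.adjoin ℚ ({β} : Set (AlgebraicClosure ℚ)))) * θI + (1478187089 : 𝓞 ↥(IntermediateField.adjoin ℚ ({β} : Set (AlgebraicClosure ℚ)))) * θI ^ 2) * ((206783836 : 𝓞 ↥(IntermediateField.adjoin ℚ ({β} : Set (AlgebraicClosure ℚ)))) + (499409023 : 𝓞 ↥(IntermediateField.adjoin ℚ ({β} : Set (AlgebraicClosure ℚ)))) * θI + (-5778920 : 𝓞 ↥(IntermediateField.adjoin ℚ ({β} : Set (AlgebraicClosure ℚ)))) *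 θI ^ 2) = 1 := by
    linear_combination ((-3520223728076593 : 𝓞 ↥(IntermediateField.adjoin ℚ ({β} : Set (AlgebraicClosure ℚ)))) * θI ^ 0 + (-8542324932363880 : 𝓞 ↥(IntermediateField.adjoin ℚ ({β} : Set (AlgebraicClosure ℚ)))) * θI ^ 1) * hrel
  have humul : ((255355336 : 𝓞 ↥(IntermediateField.adjoin ℚ ({β} : Set (AlgebraicClosure ℚ)))) + (1228646438 : 𝓞 ↥(IntermediateField.adjoin ℚ ({β} : Set (AlgebraicClosure ℚ)))) * θI + (1478187089 : 𝓞 ↥(IntermediateField.adjoin ℚ ({β} : Set (AlgebraicClosure ℚ)))) * θI ^ 2) * ((206783836 : 𝓞 ↥(IntermediateField.adjoin ℚ ({β} : Set (AlgebraicClosure ℚ)))) + (499409023 : 𝓞 ↥(IntermediateField.adjoin ℚ ({β} : Set (AlgebraicClosure ℚ)))) * θI + (-5778920 : 𝓞 ↥(IntermediateField.adjoin ℚ ({β} : Set (AlgebraicClosure ℚ)))) * θI ^ 2) = 1 := by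
    linear_combination ((-3520223728076593 : 𝓞 ↥(IntermediateField.adjoin ℚ ({β} : Set (AlgebraicClosure ℚ)))) * θI ^ 0 + (-8542324932363880 : 𝓞 ↥(IntermediateField.adjoin ℚ ({β} : Set (AlgebraicClosure ℚ)))) * θI ^ 1) * hrel
  have hψε : ψ ((255355336 : 𝓞 ↥(IntermediateField.adjoin ℚ ({β} : Set (AlgebraicClosure ℚ)))) + (1228646438 : 𝓞 ↥(IntermediateField.adjoin ℚ ({β} : Set (AlgebraicClosure ℚ)))) * θI + (1478187089 : 𝓞 ↥(IntermediateField.adjoin ℚ ({β} : Set (AlgebraicClosure ℚ)))) * θI ^ 2) = (3 : ZMod 5) := by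
    simp only [map_add, map_mul, map_pow, map_ofNat, hψ]
    decide
  have hnsq : ∀ z : (𝓞 ↥(IntermediateField.adjoin ℚ ({β} : Set (AlgebraicClosure ℚ))))ˣ, Units.mkOfMulEqOne _ _ hεmul ≠ z ^ 2 ∧ Units.mkOfMulEqOne _ _ hεmul ≠ -z ^ 2 := by
    intro z
    refine ⟨fun h => ?_, fun h => ?_⟩
    · have h' := congrArg (fun w : (𝓞 ↥(IntermediateField.adjoin ℚ ({β} : Set (AlgebraicClosure ℚ))))ˣ => ψ (w : 𝓞 ↥(IntermediateField.adjoin ℚ ({β} : Set (AlgebraicClosure ℚ))))) h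
      simp only [Units.val_mkOfMulEqOne, Units.val_pow_eq_pow_val, map_pow] at h'
      rw [hψε] at h'
      exact absurd h'.symm (by generalize ψ (z : 𝓞 ↥(IntermediateField.adjoin ℚ ({β} : Set (AlgebraicClosure ℚ)))) = t; revert t; decide)
    · have h' := congrArg (fun w : (𝓞 ↥(IntermediateField.adjoin ℚ ({β} : Set (AlgebraicClosure ℚ))))ˣ => ψ (w : 𝓞 ↥(IntermediateField.adjoin ℚ ({β} : Set (AlgebraicClosure ℚ))))) h
      simp only [Units.val_mkOfMulEqOne, Units.val_neg, Units.val_pow_eq_pow_val, map_neg, map_pow] at h'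
      rw [hψε] at h'
      exact absurd h'.symm (by generalize ψ (z : 𝓞 ↥(IntermediateField.adjoin ℚ ({β} : Set (AlgebraicClosure ℚ)))) = t; revert t; decide)
  have hε : (Units.mkOfMulEqOne _ _ hεmul : (𝓞 ↥(IntermediateField.adjoin ℚ ({β} : Set (AlgebraicClosure ℚ))))ˣ).val - 1 ∈ Ideal.span {((-1 : 𝓞 ↥(IntermediateField.adjoin ℚ ({β} : Set (AlgebraicClosure ℚ)))) + (-2 : 𝓞 ↥(IntermediateField.adjoin ℚ ({β} : Set (AlgebraicClosure ℚ)))) * θI + (1 : 𝓞 ↥(IntermediateField.adjoin ℚ ({β} : Set (AlgebraicClosure ℚ)))) * θI ^ 2)} ^ 3 ∨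
      (Units.mkOfMulEqOne _ _ hεmul : (𝓞 ↥(IntermediateField.adjoin ℚ ({β} : Set (AlgebraicClosure ℚ))))ˣ).val + 1 ∈ Ideal.span {((-1 : 𝓞 ↥(IntermediateField.adjoin ℚ ({β} : Set (AlgebraicClosure ℚ)))) + (-2 : 𝓞 ↥(IntermediateField.adjoin ℚ ({β} : Set (AlgebraicClosure ℚ)))) * θI + (1 : 𝓞 ↥(IntermediateField.adjoin ℚ ({β} : Set (AlgebraicClosure ℚ)))) * θI ^ 2)} ^ 3 := by
    refine Or.inr ?_
    rw [Units.val_mkOfMulEqOne, Ideal.span_singleton_pow, Ideal.mem_span_singleton']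
    exact ⟨((-12523097 : 𝓞 ↥(IntermediateField.adjoin ℚ ({β} : Set (AlgebraicClosure ℚ)))) + (-29639654 : 𝓞 ↥(IntermediateField.adjoin ℚ ({β} : Set (AlgebraicClosure ℚ)))) * θI + (343009 : 𝓞 ↥(IntermediateField.adjoin ℚ ({β} : Set (AlgebraicClosure ℚ)))) * θI ^ 2), by linear_combination ((16188816 : 𝓞 ↥(IntermediateField.adjoin ℚ ({β} : Set (AlgebraicClosure ℚ)))) * θI ^ 0 + (-2781770 : 𝓞 ↥(IntermediateField.adjoin ℚ ({β} : Set (AlgebraicClosure ℚ)))) * θI ^ 1 + (-264429 : 𝓞 ↥(IntermediateField.adjoin ℚ ({β} : Set (AlgebraicClosure ℚ)))) * θI ^ 2 + (3990232 : 𝓞 ↥(IntermediateField.adjoin ℚ ({β} : Set (AlgebraicClosure ℚ)))) * θI ^ 3 + (-2198934 : 𝓞 ↥(IntermediateField.adjoin ℚ ({β} : Set (AlgebraicClosure ℚ)))) * θI ^ 4 + (343009 : 𝓞 ↥(IntermediateField.adjoin ℚ ({β} : Set (AlgebraicClosure ℚ)))) * θI ^ 5) * hrel⟩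
  have hxy : ((-2 : 𝓞 ↥(IntermediateField.adjoin ℚ ({β} : Set (AlgebraicClosure ℚ)))) + (-6 : 𝓞 ↥(IntermediateField.adjoin ℚ ({β} : Set (AlgebraicClosure ℚ)))) * θI + (-3 : 𝓞 ↥(IntermediateField.adjoin ℚ ({β} : Set (AlgebraicClosure ℚ)))) * θI ^ 2) ^ 2 - 2 * ((3 : 𝓞 ↥(IntermediateField.adjoin ℚ ({β} : Set (AlgebraicClosure ℚ)))) + (8 : 𝓞 ↥(IntermediateField.adjoin ℚ ({β} : Set (AlgebraicClosure ℚ)))) * θI + (2 : 𝓞 ↥(IntermediateField.adjoin ℚ ({β} : Set (AlgebraicClosure ℚ)))) * θI ^ 2) ^ 2 = (Units.mkOfMulEqOne _ _ humul : (𝓞 ↥(IntermediateField.adjoin ℚ ({β} : Set (AlgebraicClosure ℚ))))ˣ).val * ((4406 : 𝓞 ↥(IntermediateField.adjoin ℚ ({β} : Set (AlgebraicClosure ℚ)))) + (10369 : 𝓞 ↥(IntermediateField.adjoin ℚ ({β} : Set (AlgebraicClosure ℚ)))) * θI + (-120 : 𝓞 ↥(IntermediateField.adjoin ℚ ({β}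 : Set (AlgebraicClosure ℚ)))) * θI ^ 2) ^ 2 := by
    rw [Units.val_mkOfMulEqOne]
    linear_combination ((330478083966194 : 𝓞 ↥(IntermediateField.adjoin ℚ ({β} : Set (AlgebraicClosure ℚ)))) * θI ^ 0 + (1559288168407952 : 𝓞 ↥(IntermediateField.adjoin ℚ ({β} : Set (AlgebraicClosure ℚ)))) * θI ^ 1 + (1830277862477040 : 𝓞 ↥(IntermediateField.adjoin ℚ ({β} : Set (AlgebraicClosure ℚ)))) * θI ^ 2 + (-21285894081600 : 𝓞 ↥(IntermediateField.adjoin ℚ ({β} : Set (AlgebraicClosure ℚ)))) * θI ^ 3) * hrel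
  have hbez : ((-4016 : 𝓞 ↥(IntermediateField.adjoin ℚ ({β} : Set (AlgebraicClosure ℚ)))) + (-19322 : 𝓞 ↥(IntermediateField.adjoin ℚ ({β} : Set (AlgebraicClosure ℚ)))) * θI + (-23245 : 𝓞 ↥(IntermediateField.adjoin ℚ ({β} : Set (AlgebraicClosure ℚ)))) * θI ^ 2) * ((4406 : 𝓞 ↥(IntermediateField.adjoin ℚ ({β} : Set (AlgebraicClosure ℚ)))) + (10369 : 𝓞 ↥(IntermediateField.adjoin ℚ ({β} : Set (AlgebraicClosure ℚ)))) * θI + (-120 : 𝓞 ↥(IntermediateField.adjoin ℚ ({β} : Set (AlgebraicClosure ℚ)))) * θI ^ 2) + (14 : 𝓞 ↥(IntermediateField.adjoin ℚ ({β} : Set (AlgebraicClosure ℚ)))) * ((-2 : 𝓞 ↥(IntermediateField.adjoin ℚ ({β} : Set (AlgebraicClosure ℚ)))) + (-6 : 𝓞 ↥(IntermediateField.adjoin ℚ ({β} : Set (AlgebraicClosure ℚ)))) * θI + (-3 : 𝓞 ↥(IntermediateField.adjoin ℚ ({β} : Set (AlgebraicClosure ℚ)))) * θI ^ 2) = 1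 := by
    linear_combination ((1179635 : 𝓞 ↥(IntermediateField.adjoin ℚ ({β} : Set (AlgebraicClosure ℚ)))) * θI ^ 0 + (2789400 : 𝓞 ↥(IntermediateField.adjoin ℚ ({β} : Set (AlgebraicClosure ℚ)))) * θI ^ 1) * hrel
  have hbez' : ((-1954 : 𝓞 ↥(IntermediateField.adjoin ℚ ({β} : Set (AlgebraicClosure ℚ)))) + (-9407 : 𝓞 ↥(IntermediateField.adjoin ℚ ({β} : Set (AlgebraicClosure ℚ)))) * θI + (-11324 : 𝓞 ↥(IntermediateField.adjoin ℚ ({β} : Set (AlgebraicClosure ℚ)))) * θI ^ 2) * ((4406 : 𝓞 ↥(IntermediateField.adjoin ℚ ({β} : Set (AlgebraicClosure ℚ)))) + (10369 : 𝓞 ↥(IntermediateField.adjoin ℚ ({β} : Set (AlgebraicClosure ℚ)))) * θI + (-120 : 𝓞 ↥(IntermediateField.adjoin ℚ ({β} : Set (AlgebraicClosure ℚ)))) * θI ^ 2) ^ 2 + (145 : 𝓞 ↥(IntermediateField.adjoin ℚ ({β} : Set (AlgebraicClosure ℚ)))) * 2 = 1 := by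
    linear_combination ((2528845417 : 𝓞 ↥(IntermediateField.adjoin ℚ ({β} : Set (AlgebraicClosure ℚ)))) * θI ^ 0 + (11938655956 : 𝓞 ↥(IntermediateField.adjoin ℚ ({β} : Set (AlgebraicClosure ℚ)))) * θI ^ 1 + (14021351040 : 𝓞 ↥(IntermediateField.adjoin ℚ ({β} : Set (AlgebraicClosure ℚ)))) * θI ^ 2 + (-163065600 : 𝓞 ↥(IntermediateField.adjoin ℚ ({β} : Set (AlgebraicClosure ℚ)))) * θI ^ 3) * hrel
  have hα : ((4406 : 𝓞 ↥(IntermediateField.adjoin ℚ ({β} : Set (AlgebraicClosure ℚ)))) + (10369 : 𝓞 ↥(IntermediateField.adjoin ℚ ({β} : Set (AlgebraicClosure ℚ)))) * θI + (-120 : 𝓞 ↥(IntermediateField.adjoin ℚ ({β} : Set (AlgebraicClosure ℚ)))) * θI ^ 2) - 3 ∈ Ideal.span {((-1 : 𝓞 ↥(IntermediateField.adjoin ℚ ({β} : Set (AlgebraicClosure ℚ)))) + (-2 : 𝓞 ↥(IntermediateField.adjoin ℚ ({β} : Set (AlgebraicClosure ℚ)))) * θI + (1 : 𝓞 ↥(IntermediateField.adjoin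 ℚ ({β} : Set (AlgebraicClosure ℚ)))) * θI ^ 2)} ^ 3 ∨ ((4406 : 𝓞 ↥(IntermediateField.adjoin ℚ ({β} : Set (AlgebraicClosure ℚ)))) + (10369 : 𝓞 ↥(IntermediateField.adjoin ℚ ({β} : Set (AlgebraicClosure ℚ)))) * θI + (-120 : 𝓞 ↥(IntermediateField.adjoin ℚ ({β} : Set (AlgebraicClosure ℚ)))) * θI ^ 2) + 3 ∈ Ideal.span {((-1 : 𝓞 ↥(IntermediateField.adjoin ℚ ({β} : Set (AlgebraicClosure ℚ)))) + (-2 : 𝓞 ↥(IntermediateField.adjoin ℚ ({β} : Set (AlgebraicClosure ℚ)))) * θI + (1 : 𝓞 ↥(IntermediateField.adjoin ℚ ({β} : Set (AlgebraicClosure ℚ)))) * θI ^ 2)} ^ 3 := by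
    refine Or.inl ?_
    rw [Ideal.span_singleton_pow, Ideal.mem_span_singleton']
    exact ⟨((-1535707523 : 𝓞 ↥(IntermediateField.adjoin ℚ ({β} : Set (AlgebraicClosure ℚ)))) + (-3676059847 : 𝓞 ↥(IntermediateField.adjoin ℚ ({β} : Set (AlgebraicClosure ℚ)))) * θI + (42539394 : 𝓞 ↥(IntermediateField.adjoin ℚ ({β} : Set (AlgebraicClosure ℚ)))) * θI ^ 2), by linear_combination ((-102380208 : 𝓞 ↥(IntermediateField.adjoin ℚ ({β} : Set (AlgebraicClosure ℚ)))) * θI ^ 0 + (-367927976 : 𝓞 ↥(IntermediateField.adjoin ℚ ({β} : Set (AlgebraicClosure ℚ)))) * θI ^ 1 + (-35978357 : 𝓞 ↥(IntermediateField.adjoin ℚ ({β} : Set (AlgebraicClosure ℚ)))) * θI ^ 2 + (496226351 : 𝓞 ↥(IntermediateField.adjoin ℚ ({β} : Set (AlgebraicClosure ℚ)))) * θI ^ 3 + (-272908327 : 𝓞 ↥(IntermediateField.adjoin ℚ ({β} : Set (AlgebraicClosure ℚ)))) * θI ^ 4 + (42539394 : 𝓞 ↥(IntermediateField.adjoin ℚ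 ({β} : Set (AlgebraicClosure ℚ)))) * θI ^ 5) * hrel⟩
  exact classNumberPExp_one_adjoin_eq_one_of_genusCert_odd ((⟨1, 0, 1, -10, 11⟩ : WeierstrassCurve ℤ).baseChange ℚ) hord ht minimalDiscriminantInt_emod_eight_n7419 Δ_n7419_neg hβ
    (not_two_dvd_classNumber_cubicField_n7419 hβ) hd (Ideal.span {((-1 : 𝓞 ↥(IntermediateField.adjoin ℚ ({β} : Set (AlgebraicClosure ℚ)))) + (-2 : 𝓞 ↥(IntermediateField.adjoin ℚ ({β} : Set (AlgebraicClosure ℚ)))) * θI + (1 : 𝓞 ↥(IntermediateField.adjoin ℚ ({β} : Set (AlgebraicClosure ℚ)))) * θI ^ 2)}) (absNorm_span_pi1_n7419 hβ) hε hnsq hxy hbez hbez' hα κP hκP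

/-- ★★ **`μ₂ = 0` for EVERY cyclotomic `ℤ₂`-extension of the cubic field `ℚ(β)` of discriminant `−7419`** (the form consumed by the carrier road).
[cite: Washington1997, §13.3 Prop. 13.22–13.23] [cite: LMFDB, number field 3.1.7419.1] -/
theorem classicalMuVanishes_cubicField_n7419 {β : AlgebraicClosure ℚ} (hβ : aeval β ((⟨1, 0, 1, -10, 11⟩ : WeierstrassCurve ℤ).baseChange ℚ).twoTorsionPolynomial.toPoly = 0)
    (κP : ZpExtension ↥(IntermediateField.adjoin ℚ ({β} : Set (AlgebraicClosure ℚ))) 2) (hκP : κP.IsCyclotomic) : ClassicalMuVanishes κP :=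
  (classGroupPRank_le_one_cubicField_n7419 hβ κP hκP).2.1


/-! ## §3 The kernel row: `MC₂(W)` for `W = ⟨1, 0, 1, -10, 11⟩` modulo PRINT⁵ + MuIneqʳ (C2 at this seed) -/

/-- The `2`-division cubic of `⟨1, 0, 1, -10, 11⟩` has a root in `ℚ̄`. [cite: SilvermanAEC2009, III.1] -/
theorem exists_root_twoTorsionPolynomial_n7419 :
    ∃ β : AlgebraicClosure ℚ, aeval β ((⟨1, 0, 1, -10, 11⟩ : WeierstrassCurve ℤ).baseChange ℚ).twoTorsionPolynomial.toPoly = 0 := by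
  apply IsAlgClosed.exists_aeval_eq_zero
  rw [Cubic.degree_of_a_ne_zero (by simp [WeierstrassCurve.twoTorsionPolynomial])]
  decide

/-- ★ **THE I — `C2` AT THE SEED `⟨1, 0, 1, -10, 11⟩` (`N = 7419`): `MazurMainConjecture W 2`** from PRINT⁵ {`h17` Kato 17.4 (1)(2) at `2`, `hGr` Greenberg 4.1,
`hper` period unit, `hmod` modularity, `hGZK`} + `hI` = MuIneqʳ (the registered stub of line `birth`, VERBATIM) + the crux's own hypotheses at this `W`
(`r_an = 0`, analytic `μ₂ = 0` on the even branch, `BSD₂(W)`).  Every other binder of att-p5 g24's carrier road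
`mazurMainConjecture_two_of_muIneqRel_of_classicalMu_cubicField_of_Δ_neg` — good ordinary reduction at `2`, no rational `2`-torsion abscissa, `Δ < 0`,
and `μ₂ = 0` for every cyclotomic `ℤ₂`-extension of `ℚ(β)` — is a theorem of this file / of att-p4 g38's row.  CONDITIONAL on the named facts and the stub;
BSD is NOT proved; nothing is closed. [cite: Kato2004Asterisque, Thm. 17.4 (1)(2) (p. 273)] [cite: GreenbergLNM1716, Thm. 4.1 (p. 102) and Conj. 1.11 (p. 58)]
[cite: Iwasawa1973MuInvariants, Thm. 2 and Thm. 3] [cite: Washington1997, §13.3 Prop. 13.22–13.23] -/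
theorem mazurMainConjecture_two_n7419
    [((⟨1, 0, 1, -10, 11⟩ : WeierstrassCurve ℤ).baseChange ℚ).IsElliptic] [((⟨1, 0, 1, -10, 11⟩ : WeierstrassCurve ℤ).baseChange ℚ).IsGloballyMinimal]
    (h17 : ∀ [NeZero (((⟨1, 0, 1, -10, 11⟩ : WeierstrassCurve ℤ).baseChange ℚ).conductorNorm ℤ)] (f : CuspForm (Gamma0 (((⟨1, 0, 1, -10, 11⟩ : WeierstrassCurve ℤ).baseChange ℚ).conductorNorm ℤ)) 2),
      kato_divisibility_allPrimes ((⟨1, 0, 1, -10, 11⟩ : WeierstrassCurve ℤ).baseChange ℚ) 2 (f := f))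
    (hGr : Greenberg1999.thm41_charValue_rankZero_anyPrime)
    (hper : realPeriodRat_eq_unit_mul_plusPeriod_two) (hmod : nonempty_modularParametrizationData)
    (hGZK : rank_eq_analyticRank_of_analyticRank_le_one)
    (hI : ∀ (W : WeierstrassCurve ℚ) [W.IsElliptic] [W.IsGloballyMinimal], IsOrdinaryAt W 2 →
      (∀ x : ℚ, ¬ HasRationalTwoTorsionX W x) →
      ∀ (κ : ZpExtension ℚ 2) (γ : Field.absoluteGaloisGroup ℚ), κ.IsCyclotomic →
      κ.IsTopGenerator γ → IsCyclotomicVariable 2 γ →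
      ∀ ⦃N : ℕ⦄ [NeZero N] (f : CuspForm (Gamma0 N) 2), IsNewformOf W f →
      ∀ Gp : IwasawaAlgebra 2, iwasawaToPowerSeries 2 Gp = padicLFunction f (unitRoot W 2 : ℚ_[2]) →
      ∀ (D : W.SelmerDualData κ γ) (Yr : W.FineSelmerDualDataRelaxedInf κ γ),
        lengthAt (IwasawaAlgebra 2) D.X ⟨IwasawaAlgebra.augIdealP 2, IwasawaAlgebra.isPrime_augIdealP_holds 2⟩ ≤
          lengthAt (IwasawaAlgebra 2) (IwasawaAlgebra 2 ⧸ Ideal.span {Gp})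
              ⟨IwasawaAlgebra.augIdealP 2, IwasawaAlgebra.isPrime_augIdealP_holds 2⟩ +
            lengthAt (IwasawaAlgebra 2) Yr.X ⟨IwasawaAlgebra.augIdealP 2, IwasawaAlgebra.isPrime_augIdealP_holds 2⟩)
    (hr : ((⟨1, 0, 1, -10, 11⟩ : WeierstrassCurve ℤ).baseChange ℚ).analyticRank = 0)
    (hμan : ∀ ⦃N : ℕ⦄ [NeZero N] (f : CuspForm (Gamma0 N) 2), IsNewformOf ((⟨1, 0, 1, -10, 11⟩ : WeierstrassCurve ℤ).baseChange ℚ) f →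
      ∀ G : IwasawaAlgebra 2, IsEvenBranchLiftAtTwo ((⟨1, 0, 1, -10, 11⟩ : WeierstrassCurve ℤ).baseChange ℚ) f G → red G ≠ 0)
    (hbsd : BSDp ((⟨1, 0, 1, -10, 11⟩ : WeierstrassCurve ℤ).baseChange ℚ) 2) :
    MazurMainConjecture ((⟨1, 0, 1, -10, 11⟩ : WeierstrassCurve ℤ).baseChange ℚ) 2 := by
  obtain ⟨β, hβ⟩ := exists_root_twoTorsionPolynomial_n7419
  exact mazurMainConjecture_two_of_muIneqRel_of_classicalMu_cubicField_of_Δ_neg ((⟨1, 0, 1, -10, 11⟩ : WeierstrassCurve ℤ).baseChange ℚ) h17 hGr hper hmod hGZK hI goodOrd_two_n7419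
    not_hasRationalTwoTorsionX_n7419 Δ_n7419_neg hr hμan hbsd hβ (fun κP hκP => classicalMuVanishes_cubicField_n7419 hβ κP hκP)

end Summit.BirchSwinnertonDyer.BirchSwinnertonDyer.Theorems.AlignedTransportAtTwoCubicDepthDoorRowN7419

end
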